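import Mathlib

/-!
# The zero set of a non-trivial analytic function has empty interior (support, seat p1)

The «identity theorem» input of the density glue (`T7SupportDenseRegularPoint.exists_mem_dense_ne_zero_notMem`,
`T7SupportWeightTorusContinuous.exists_mem_dense_torusOrbital_ne_zero_notMem`): on a preconnected open set `U` of
a normed space over `𝕜 = ℝ` or `ℂ`, a function analytic on `U` and not identically zero on `U` has a zero set whose
interior is empty (`interior_zeroSet_eq_empty`, `U` preconnected; `Mathlib`'s
`AnalyticOnNhd.eqOn_zero_of_preconnected_of_eventuallyEq_zero`): if the zero set contained a neighbourhood of a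
point of `U`, `f` would vanish near that point, hence on all of `U`. Equivalently, every point of `U` is a limit of
points where `f ≠ 0` (`frequently_ne_zero`), the form `T7SupportDenseRegularPoint.interior_eq_empty_of_frequently`
consumes. `AnalyticOnNhd ℝ` on an open set is the real-analyticity of a matrix coefficient of a finite-dimensional
representation in a coordinate chart of a compact Lie group, or of `t ↦ ⟪y, τ(a_t) x⟫` along a one-parameter
subgroup — the passage from the group to a chart (or to the parameter) stays with the line.

Nothing here is about any group or any period.
Blind lane: Mathlib only; no sorry; axioms ⊆ {propext, Classical.choice, Quot.sound}.
-/

namespace Summit.Ventures.HodgeRepro2.T7SupportAnalyticZeroSet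

open Filter Topology Set

variable {𝕜 : Type*} [NontriviallyNormedField 𝕜] {E : Type*} [NormedAddCommGroup E] [NormedSpace 𝕜 E]
  {F : Type*} [NormedAddCommGroup F] [NormedSpace 𝕜 F]

/-- **a function analytic on a preconnected open set and vanishing near one point of it vanishes on all of it**
(restated from `AnalyticOnNhd.eqOn_zero_of_preconnected_of_eventuallyEq_zero`) -/
theorem eqOn_zero_of_eventuallyEq_zero {f : E → F} {U : Set E} (hf : AnalyticOnNhd 𝕜 f U)
    (hU : IsPreconnected U) {z₀ : E} (hz₀ : z₀ ∈ U) (h : f =ᶠ[𝓝 z₀] 0) : EqOn f 0 U :=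
  hf.eqOn_zero_of_preconnected_of_eventuallyEq_zero hU hz₀ h

/-- **every point of `U` is a limit of points where `f ≠ 0`** when `f` is analytic on the preconnected open `U`
and not identically zero on `U` -/
theorem frequently_ne_zero {f : E → F} {U : Set E} (hf : AnalyticOnNhd 𝕜 f U) (hU : IsPreconnected U)
    (hne : ∃ z ∈ U, f z ≠ 0) {z₀ : E} (hz₀ : z₀ ∈ U) : ∃ᶠ z in 𝓝 z₀, f z ≠ 0 := by
  rw [Filter.Frequently]
  intro hev
  -- `hev : ∀ᶠ z in 𝓝 z₀, ¬ f z ≠ 0`, i.e. `f = 0` near `z₀`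
  have h0 : f =ᶠ[𝓝 z₀] 0 := hev.mono fun z hz => by
    simp only [Pi.zero_apply]
    exact not_not.1 hz
  obtain ⟨z, hzU, hz⟩ := hne
  exact hz (eqOn_zero_of_eventuallyEq_zero hf hU hz₀ h0 hzU)

/-- **the zero set of a non-trivial analytic function has empty interior** (`U` preconnected) -/
theorem interior_zeroSet_eq_empty {f : E → F} {U : Set E} (hf : AnalyticOnNhd 𝕜 f U) (hU : IsPreconnected U)
    (hne : ∃ z ∈ U, f z ≠ 0) : interior {z | z ∈ U ∧ f z = 0} = ∅ := by
  ext z₀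
  simp only [mem_empty_iff_false, iff_false]
  intro hz₀
  have hnhds : {z | z ∈ U ∧ f z = 0} ∈ 𝓝 z₀ := mem_interior_iff_mem_nhds.1 hz₀
  have hz₀U : z₀ ∈ U := (mem_of_mem_nhds hnhds).1
  have h0 : f =ᶠ[𝓝 z₀] 0 := Filter.Eventually.mono hnhds fun z hz => by
    simp only [Pi.zero_apply]
    exact hz.2
  obtain ⟨z, hzU, hz⟩ := hne
  exact hz (eqOn_zero_of_eventuallyEq_zero hf hU hz₀U h0 hzU)

/-- the same for a function analytic on the whole space (`U = univ`, preconnected when `E` is) -/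
theorem interior_zeroSet_eq_empty_univ [PreconnectedSpace E] {f : E → F} (hf : AnalyticOnNhd 𝕜 f univ)
    (hne : ∃ z, f z ≠ 0) : interior {z | f z = 0} = ∅ := by
  have h := interior_zeroSet_eq_empty hf isPreconnected_univ (hne.imp fun z hz => ⟨mem_univ z, hz⟩)
  simpa only [mem_univ, true_and] using h

/-- the zero set of a non-trivial analytic function on the whole space is closed with empty interior — the
exceptional-set hypotheses of the density glue, for a continuous `f` -/
theorem isClosed_zeroSet_and_interior_eq_empty [PreconnectedSpace E] {f : E → F}
    (hf : AnalyticOnNhd 𝕜 f univ) (hne : ∃ z, f z ≠ 0) :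
    IsClosed {z | f z = 0} ∧ interior {z | f z = 0} = ∅ :=
  ⟨isClosed_eq (continuousOn_univ.1 hf.continuousOn) continuous_const,
    interior_zeroSet_eq_empty_univ hf hne⟩

end Summit.Ventures.HodgeRepro2.T7SupportAnalyticZeroSet
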